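import Mathlib
import Summits.NavierStokesRegularity.OSWSelfSimilar.SheetNSLineCornerRealPart
import Summits.NavierStokesRegularity.OSWSelfSimilar.SheetNSLineCornerODE
import Summits.NavierStokesRegularity.OSWSelfSimilar.SheetHalfLineVelocityKernel
import Literature.Analysis.Fourier.HilbertTransformLineCotlar
import HarnessLib

/-!
# Viscous CLM profile MODEL: CLASSIFICATION OF THE SCHOCHET CORNER — every census-class solution of
# `(HΩ)Ω + εΩ″ = 0` is `0` or a Schochet double pole `−24εℓη/(η²+ℓ²)²`

HONEST FRAMING (cell ns-blowup GROUP B «PROFILE SEARCH», zone Z3 = the 1-D viscous gCLM/OSW sheet; human rulings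
D-0035/D-0074): **1-D MODEL; one-variable analysis kernel-checked; not Euler, not Navier–Stokes; «violates: none — MODEL».**
Nothing in this file is a statement about Navier–Stokes.

OBJECT / CLASS: as in `SheetNSLineCornerRealPart` — the degenerate corner `(c_ω, c_l, a) = (0, 0, 0)`, `b = 1`, `P = 0` of the
NS-type line of the frozen-`ε` sheet (`F₁ ≡ 0` on `(0,∞)`, i.e. `(HΩ)Ω + εΩ″ = 0`), census class: `Ω` odd `C²`, `|Ω′| ≤ M`,
`|Ω| ≤ C/(1+ξ²)`, genuine `hilbertTransform`, `ε > 0`. Write `h = HΩ`.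

WHAT IS KERNEL-CHECKED HERE:
* `corner_regularity` — `h′ = H(Ω′)`, `Ω‴ = −(h′Ω + hΩ′)/ε ∈ L¹`, `h″ = H(Ω″)` (`hasDerivAt_hilbertTransform` twice, with the
  envelopes `|Ω′| ≤ C₁/(1+ξ²)`, `|Ω″| ≤ C₂/(1+ξ²)` bootstrapped in `SheetNSLineCornerRealPart`);
* `corner_fourier_integrable` — `𝓕Ω ∈ L¹` and `𝓕Ω′ ∈ L¹` (`𝓕(f′) = 2πik·𝓕f` three times);
* `corner_cotlar` / **`corner_realPart`** — `H(Ω·h) = ½(h² − Ω²)` (the Tricomi–Cotlar rule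
  `Literature…hilbertTransform_mul_hilbertTransform`, all hypotheses discharged inside the class) and `ε·h″ = ½(Ω² − h²)`;
* `corner_analyticSignal_ode` — `W = Ω + ih` is `C²` on `ℝ` with `εW″ = (i/2)W²` and `W, W′ → 0` at `+∞`
  (Riemann–Lebesgue on `W = 𝓕⁻[(1+sgn)𝓕Ω]`, `W′ = 𝓕⁻[(1+sgn)𝓕Ω′]`);
* **`corner_classification` — THE CENSUS DECL: `Ω = 0 ∨ ∃ ℓ > 0, Ω = fun η => −(24εℓ)η/(η²+ℓ²)²`** (binders = those of
  `SheetHalfLine.nsTypeLine_empty_of_a_eq_zero` at `c_ω := 0` minus `hcω`, `iH`, `hdOm1`; no extra binder): by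
  `SheetNSLineCornerODE.classification_corner`, oddness (`Re z₀ = 0`) and `h = HΩ` against the explicit Hilbert transform of
  the double pole (`hilbertTransform_doublePole_dilate`), which forces `Im z₀ < 0`.
This is the converse of `SheetNSLineSchochetCorner.schochetCorner_solves_nsLine_equation` (p464720): AT the corner the class
consists EXACTLY of Schochet's one-parameter family [Schochet 1986; ALSS 2024 §5.1.1] and `0`.
NOT HERE: anything for `a ≠ 0` or `c_ω ≠ 0`, anything dynamic, stability, anything about Euler or NS. No definitions;
no `def … : Prop` hypotheses; standard axioms.
bears_on: LADDER-NS N5 / zone Z3 row Z3-E12⁻ clause (i′) («the Schochet corner is the divide») → N1 linear core.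
-/

noncomputable section
open Set Filter Topology MeasureTheory Complex
open Literature.Analysis.Fourier
open scoped Real FourierTransform

namespace Summit.NavierStokesRegularity.OSWSelfSimilar
namespace SheetNSLineCorner
open HouLuoOriginLaws (F1)
open SheetHalfLine SheetNSLineCornerODE

/-! ### Plumbing -/

/-- `C²` bookkeeping from `HasDerivAt` data. [folklore] -/
theorem contDiff_two_of_hasDerivAt {f df ddf : ℝ → ℝ} (hf : ∀ x, HasDerivAt f (df x) x)
    (hdf : ∀ x, HasDerivAt df (ddf x) x) (hddf : Continuous ddf) :
    ContDiff ℝ 2 f ∧ deriv f = df ∧ deriv (deriv f) = ddf := by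
  have hd : deriv f = df := funext fun x => (hf x).deriv
  have hdd : deriv df = ddf := funext fun x => (hdf x).deriv
  refine ⟨?_, hd, by rw [hd, hdd]⟩
  have h1 : ContDiff ℝ 1 df := by
    rw [contDiff_one_iff_deriv]; exact ⟨fun x => (hdf x).differentiableAt, by rw [hdd]; exact hddf⟩
  have : ContDiff ℝ (1 + 1) f := by
    rw [contDiff_succ_iff_deriv]
    exact ⟨fun x => (hf x).differentiableAt, by intro h; simp at h, by rw [hd]; exact h1⟩
  exact this

/-! ### Regularity chain: `h′ = H(Ω′)`, `Ω‴`, `h″ = H(Ω″)` -/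

/-- **Regularity at the corner.** In the class: `h = HΩ` is differentiable with `h′ = H(Ω′)`; `H(Ω′)` is continuous and
bounded; `Ω‴ = −(H(Ω′)Ω + hΩ′)/ε` (so `Ω″` is `C¹`) is integrable; and `H(Ω′)` is differentiable with derivative `H(Ω″)`.
[new here — MODEL] -/
theorem corner_regularity {ε M C : ℝ} {U Om dOm ddOm : ℝ → ℝ} (hε : 0 < ε) (hodd : ∀ y, Om (-y) = -Om y)
    (hOm : ∀ ξ, HasDerivAt Om (dOm ξ) ξ) (hdOm : ∀ ξ, HasDerivAt dOm (ddOm ξ) ξ)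
    (hM : ∀ y, |dOm y| ≤ M) (hC : ∀ y, |Om y| ≤ C / (1 + y ^ 2))
    (hF : ∀ ξ ∈ Ioi (0:ℝ), F1 0 0 0 1 ε (hilbertTransform Om) U Om dOm ddOm (fun _ => 0) ξ = 0) :
    (∀ x, HasDerivAt (hilbertTransform Om) (hilbertTransform dOm x) x) ∧
    Continuous (hilbertTransform dOm) ∧ (∃ B', ∀ x, |hilbertTransform dOm x| ≤ B') ∧ Integrable dOm ∧ MemLp dOm 2 ∧
    (∀ x, HasDerivAt ddOm (-(hilbertTransform dOm x * Om x + hilbertTransform Om x * dOm x) / ε) x) ∧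
    Integrable (fun x => -(hilbertTransform dOm x * Om x + hilbertTransform Om x * dOm x) / ε) ∧
    (∀ x, HasDerivAt (hilbertTransform dOm) (hilbertTransform ddOm x) x) := by
  obtain ⟨hc, hdc, hΩi, hΩ2, hint, hhc, hhb⟩ := corner_basic hOm hdOm hM hC
  have hode := corner_ode hodd hOm hdOm hF
  obtain ⟨C₁, hC₁⟩ := corner_dOm_env hε hodd hOm hdOm hM hC hF
  have hC₂ := corner_ddOm_env hε hodd hOm hdOm hM hC hF
  set C₂ : ℝ := π⁻¹ * (2 * M + 2 * ∫ y, |Om y|) * C / ε with hC₂def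
  -- `Ω″` is continuous: `Ω″ = −hΩ/ε`
  have hdd_eq : ddOm = fun y => -(hilbertTransform Om y * Om y) / ε := by
    funext y; have := hode y; field_simp; linarith
  have hddc : Continuous ddOm := by rw [hdd_eq]; exact ((hhc.mul hc).neg).div_const _
  obtain ⟨hΩC2, hd1, hd2⟩ := contDiff_two_of_hasDerivAt hOm hdOm hddc
  -- `h′ = H(Ω′)`
  have hh' : ∀ x, HasDerivAt (hilbertTransform Om) (hilbertTransform dOm x) x := by
    intro x
    have h := hasDerivAt_hilbertTransform (M := C₂) (C := C₁) hΩC2 hΩi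
      (fun y => by rw [hd2]; exact abs_le_const_of_env hC₂ y) (fun y => by rw [hd1]; exact hC₁ y) x
    rwa [hd1] at h
  -- `Ω′ ∈ C¹ ∩ L¹ ∩ L²`, `H(Ω′)` continuous and bounded
  have hdOmi : Integrable dOm := integrable_of_env hdc hC₁
  have hdOm2 : MemLp dOm 2 := memLp_two_of_env hdc hC₁
  have hdOmC1 : ContDiff ℝ 1 dOm := by
    rw [contDiff_one_iff_deriv]
    exact ⟨fun y => (hdOm y).differentiableAt, by rw [show deriv dOm = ddOm from funext fun y => (hdOm y).deriv]; exact hddc⟩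
  have hHdc : Continuous (hilbertTransform dOm) := SheetRWeakProfilePV.continuous_hilbertTransform_of_contDiff hdOmC1 hdOmi
  have hHdb : ∀ x, |hilbertTransform dOm x| ≤ π⁻¹ * (2 * C₂ + 2 * ∫ y, |dOm y|) :=
    abs_hilbertTransform_le hdOm hddc (abs_le_const_of_env hC₂) hdOmi
  -- `Ω‴`
  have hddd : ∀ x, HasDerivAt ddOm (-(hilbertTransform dOm x * Om x + hilbertTransform Om x * dOm x) / ε) x := by
    intro x
    rw [hdd_eq]
    exact (((hh' x).mul (hOm x)).neg).div_const ε |>.congr_deriv (by ring)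
  have hdddc : Continuous fun x => -(hilbertTransform dOm x * Om x + hilbertTransform Om x * dOm x) / ε :=
    (((hHdc.mul hc).add (hhc.mul hdc)).neg).div_const _
  have hdddi : Integrable fun x => -(hilbertTransform dOm x * Om x + hilbertTransform Om x * dOm x) / ε := by
    have h1 : Integrable fun x => hilbertTransform dOm x * Om x :=
      hΩi.bdd_mul hHdc.aestronglyMeasurable (ae_of_all _ fun x => by rw [Real.norm_eq_abs]; exact hHdb x)
    have h2 : Integrable fun x => hilbertTransform Om x * dOm x :=
      hdOmi.bdd_mul hhc.aestronglyMeasurable (ae_of_all _ fun x => by rw [Real.norm_eq_abs]; exact hhb x)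
    exact ((h1.add h2).neg).div_const _
  -- `h″ = H(Ω″)`: the derivative lemma applied to `Ω′`
  obtain ⟨hdOmC2, he1, he2⟩ := contDiff_two_of_hasDerivAt hdOm hddd hdddc
  obtain ⟨B₃, hB₃⟩ : ∃ B₃, ∀ x, |(-(hilbertTransform dOm x * Om x + hilbertTransform Om x * dOm x) / ε)| ≤ B₃ := by
    refine ⟨((π⁻¹ * (2 * C₂ + 2 * ∫ y, |dOm y|)) * C + (π⁻¹ * (2 * M + 2 * ∫ y, |Om y|)) * M) / ε, fun x => ?_⟩
    rw [abs_div, abs_neg, abs_of_pos hε]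
    refine div_le_div_of_nonneg_right ((abs_add_le _ _).trans ?_) hε.le
    rw [abs_mul, abs_mul]
    exact add_le_add (mul_le_mul (hHdb x) (abs_le_const_of_env hC x) (abs_nonneg _) ((abs_nonneg _).trans (hHdb 0)))
      (mul_le_mul (hhb x) (hM x) (abs_nonneg _) ((abs_nonneg _).trans (hhb 0)))
  have hh'' : ∀ x, HasDerivAt (hilbertTransform dOm) (hilbertTransform ddOm x) x := by
    intro x
    have h := hasDerivAt_hilbertTransform (M := B₃) (C := C₂) hdOmC2 hdOmi
      (fun y => by rw [he2]; exact hB₃ y) (fun y => by rw [he1]; exact hC₂ y) x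
    rwa [he1] at h
  exact ⟨hh', hHdc, ⟨_, hHdb⟩, hdOmi, hdOm2, hddd, hdddi, hh''⟩

/-! ### `𝓕Ω, 𝓕Ω′ ∈ L¹` -/

/-- If `g ∈ L¹` and `𝓕(g₂) = −4π²k²·𝓕g` for some `g₂` (e.g. `g₂ = g″ ∈ L¹`), then `𝓕g ∈ L¹`
(majorant `2(‖g‖₁ + ‖g₂‖₁/(4π²))/(1+k²)`; `‖𝓕g₂‖ ≤ ‖g₂‖₁` holds unconditionally). [folklore] -/
theorem integrable_fourier_of_sq_mul {g g2 : ℝ → ℂ} (hg : Integrable g)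
    (hrel : ∀ k : ℝ, 𝓕 g2 k = -(4 * π ^ 2 * k ^ 2 : ℝ) • 𝓕 g k) : Integrable (𝓕 g) := by
  have hFc : Continuous (𝓕 g) := Literature.Analysis.FunctionSpaces.continuous_fourierIntegral hg
  set B₀ : ℝ := ∫ x, ‖g x‖ with hB₀
  set B₂ : ℝ := ∫ x, ‖g2 x‖ with hB₂
  have hb0 : ∀ k, ‖𝓕 g k‖ ≤ B₀ := fun k => VectorFourier.norm_fourierIntegral_le_integral_norm 𝐞 volume (innerₗ ℝ) g k
  have hb2 : ∀ k, ‖𝓕 g2 k‖ ≤ B₂ := fun k => VectorFourier.norm_fourierIntegral_le_integral_norm 𝐞 volume (innerₗ ℝ) g2 k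
  have hB00 : 0 ≤ B₀ := integral_nonneg fun x => norm_nonneg _
  have hB20 : 0 ≤ B₂ := integral_nonneg fun x => norm_nonneg _
  refine ((integrable_inv_one_add_sq.const_mul (2 * (B₀ + B₂ / (4 * π ^ 2)))).mono' hFc.aestronglyMeasurable
    (ae_of_all _ fun k => ?_))
  have hpos : 0 < 1 + k ^ 2 := by positivity
  rw [← div_eq_mul_inv, le_div_iff₀ hpos]
  rcases le_or_gt (k ^ 2) 1 with hk | hk
  · calc ‖𝓕 g k‖ * (1 + k ^ 2) ≤ B₀ * 2 := mul_le_mul (hb0 k) (by linarith) hpos.le hB00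
      _ ≤ 2 * (B₀ + B₂ / (4 * π ^ 2)) := by nlinarith [div_nonneg hB20 (by positivity : (0:ℝ) ≤ 4 * π ^ 2)]
  · -- `‖𝓕g k‖ = ‖𝓕g2 k‖/(4π²k²)`
    have hk0 : 0 < k ^ 2 := by linarith
    have hkne : k ≠ 0 := by rintro rfl; norm_num at hk
    have h1 : ‖𝓕 g k‖ = ‖𝓕 g2 k‖ / (4 * π ^ 2 * k ^ 2) := by
      rw [hrel k, norm_smul, Real.norm_eq_abs, abs_neg, abs_of_pos (by positivity)]; field_simp
    rw [h1]
    calc ‖𝓕 g2 k‖ / (4 * π ^ 2 * k ^ 2) * (1 + k ^ 2) ≤ B₂ / (4 * π ^ 2 * k ^ 2) * (2 * k ^ 2) := by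
          gcongr; · exact hb2 k
          · linarith
      _ = 2 * (B₂ / (4 * π ^ 2)) := by field_simp
      _ ≤ 2 * (B₀ + B₂ / (4 * π ^ 2)) := by nlinarith

/-- **`𝓕Ω ∈ L¹` and `𝓕Ω′ ∈ L¹`** in the class at the corner (`Ω, Ω′, Ω″, Ω‴ ∈ L¹` and `Real.fourier_deriv`). [new here — MODEL] -/
theorem corner_fourier_integrable {ε M C : ℝ} {U Om dOm ddOm : ℝ → ℝ} (hε : 0 < ε) (hodd : ∀ y, Om (-y) = -Om y)
    (hOm : ∀ ξ, HasDerivAt Om (dOm ξ) ξ) (hdOm : ∀ ξ, HasDerivAt dOm (ddOm ξ) ξ)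
    (hM : ∀ y, |dOm y| ≤ M) (hC : ∀ y, |Om y| ≤ C / (1 + y ^ 2))
    (hF : ∀ ξ ∈ Ioi (0:ℝ), F1 0 0 0 1 ε (hilbertTransform Om) U Om dOm ddOm (fun _ => 0) ξ = 0) :
    Integrable (𝓕 (fun y => (Om y : ℂ))) ∧ Integrable (𝓕 (fun y => (dOm y : ℂ))) := by
  obtain ⟨hc, hdc, hΩi, -, -, hhc, -⟩ := corner_basic hOm hdOm hM hC
  obtain ⟨-, -, -, hdOmi, -, hddd, hdddi, -⟩ := corner_regularity hε hodd hOm hdOm hM hC hF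
  have hC₂ := corner_ddOm_env hε hodd hOm hdOm hM hC hF
  have hddc : Continuous ddOm := continuous_iff_continuousAt.mpr fun x => (hddd x).continuousAt
  have hddi : Integrable ddOm := integrable_of_env hddc hC₂
  -- complexified derivatives
  have e0 : deriv (fun y => (Om y : ℂ)) = fun y => (dOm y : ℂ) := funext fun y => (hOm y).ofReal_comp.deriv
  have e1 : deriv (fun y => (dOm y : ℂ)) = fun y => (ddOm y : ℂ) := funext fun y => (hdOm y).ofReal_comp.deriv
  have e2 : deriv (fun y => (ddOm y : ℂ)) = fun y => ((-(hilbertTransform dOm y * Om y + hilbertTransform Om y * dOm y) / ε : ℝ) : ℂ) :=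
    funext fun y => (hddd y).ofReal_comp.deriv
  have hF0 : 𝓕 (fun y => (dOm y : ℂ)) = fun k : ℝ => (2 * π * I * k) • 𝓕 (fun y => (Om y : ℂ)) k := by
    have h := Real.fourier_deriv (f := fun y => (Om y : ℂ)) hΩi.ofReal
      (fun y => (hOm y).ofReal_comp.differentiableAt) (by rw [e0]; exact hdOmi.ofReal)
    rw [e0] at h; exact h
  have hF1 : 𝓕 (fun y => (ddOm y : ℂ)) = fun k : ℝ => (2 * π * I * k) • 𝓕 (fun y => (dOm y : ℂ)) k := by
    have h := Real.fourier_deriv (f := fun y => (dOm y : ℂ)) hdOmi.ofReal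
      (fun y => (hdOm y).ofReal_comp.differentiableAt) (by rw [e1]; exact hddi.ofReal)
    rw [e1] at h; exact h
  have hF2 : 𝓕 (fun y => ((-(hilbertTransform dOm y * Om y + hilbertTransform Om y * dOm y) / ε : ℝ) : ℂ))
      = fun k : ℝ => (2 * π * I * k) • 𝓕 (fun y => (ddOm y : ℂ)) k := by
    have h := Real.fourier_deriv (f := fun y => (ddOm y : ℂ)) hddi.ofReal
      (fun y => (hddd y).ofReal_comp.differentiableAt) (by rw [e2]; exact hdddi.ofReal)
    rw [e2] at h; exact h
  have hsq : ∀ (a : ℂ) (k : ℝ), (2 * π * I * k) • ((2 * π * I * k) • a) = -(4 * π ^ 2 * k ^ 2 : ℝ) • a := by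
    intro a k
    rw [smul_smul, Complex.real_smul]; push_cast
    have hI : I * I = -1 := Complex.I_mul_I
    congr 1; linear_combination (4 * π ^ 2 * k ^ 2 : ℂ) * hI
  constructor
  · refine integrable_fourier_of_sq_mul (g := fun y => (Om y : ℂ)) (g2 := fun y => (ddOm y : ℂ))
      hΩi.ofReal fun k => ?_
    rw [hF1, hF0]; exact hsq _ k
  · refine integrable_fourier_of_sq_mul (g := fun y => (dOm y : ℂ))
      (g2 := fun y => ((-(hilbertTransform dOm y * Om y + hilbertTransform Om y * dOm y) / ε : ℝ) : ℂ))
      hdOmi.ofReal fun k => ?_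
    rw [hF2, hF1]; exact hsq _ k

/-! ### The Cotlar identity in the class and the real-part equation -/

/-- **`H(Ω·h) = ½(h² − Ω²)` in the class** (`h = HΩ`): the Tricomi–Cotlar rule with every regularity hypothesis discharged
at the corner (`B = 2Ωh ∈ C¹ ∩ L¹`, `HB` continuous, `𝓕Ω ∈ L¹`). [new here — MODEL; identity: King vol. 2 (19.283)–(19.284)] -/
theorem corner_cotlar {ε M C : ℝ} {U Om dOm ddOm : ℝ → ℝ} (hε : 0 < ε) (hodd : ∀ y, Om (-y) = -Om y)
    (hOm : ∀ ξ, HasDerivAt Om (dOm ξ) ξ) (hdOm : ∀ ξ, HasDerivAt dOm (ddOm ξ) ξ)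
    (hM : ∀ y, |dOm y| ≤ M) (hC : ∀ y, |Om y| ≤ C / (1 + y ^ 2))
    (hF : ∀ ξ ∈ Ioi (0:ℝ), F1 0 0 0 1 ε (hilbertTransform Om) U Om dOm ddOm (fun _ => 0) ξ = 0) (x : ℝ) :
    hilbertTransform (fun y => Om y * hilbertTransform Om y) x = (hilbertTransform Om x ^ 2 - Om x ^ 2) / 2 := by
  obtain ⟨hc, hdc, hΩi, hΩ2, hint, hhc, -⟩ := corner_basic hOm hdOm hM hC
  obtain ⟨hh', hHdc, -, -, -, -, -, -⟩ := corner_regularity hε hodd hOm hdOm hM hC hF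
  obtain ⟨hFΩ, -⟩ := corner_fourier_integrable hε hodd hOm hdOm hM hC hF
  -- `B = 2Ωh ∈ C¹ ∩ L¹`, its p.v. integrand, continuity of `HB`
  have hBd : ∀ y, HasDerivAt (fun y => 2 * Om y * hilbertTransform Om y)
      (2 * (dOm y * hilbertTransform Om y + Om y * hilbertTransform dOm y)) y := fun y => by
    have h0 : HasDerivAt (fun y => Om y * hilbertTransform Om y)
        (dOm y * hilbertTransform Om y + Om y * hilbertTransform dOm y) y := (hOm y).mul (hh' y)
    exact (h0.const_mul 2).congr_of_eventuallyEq (Eventually.of_forall fun t => by ring)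
  have hBdc : Continuous fun y => 2 * (dOm y * hilbertTransform Om y + Om y * hilbertTransform dOm y) :=
    continuous_const.mul ((hdc.mul hhc).add (hc.mul hHdc))
  have hBi : Integrable (fun y => 2 * Om y * hilbertTransform Om y) := by
    have h0 : Integrable (fun y => Om y * hilbertTransform Om y) :=
      hΩ2.integrable_mul (memLp_two_hilbertTransform hΩi hΩ2 (ae_of_all _ hint))
    exact (h0.const_mul 2).congr (ae_of_all _ fun y => by ring)
  have hB1 : ContDiff ℝ 1 (fun y => 2 * Om y * hilbertTransform Om y) := by
    rw [contDiff_one_iff_deriv]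
    exact ⟨fun y => (hBd y).differentiableAt,
      by rw [show deriv (fun y => 2 * Om y * hilbertTransform Om y) = _ from funext fun y => (hBd y).deriv]; exact hBdc⟩
  exact hilbertTransform_mul_hilbertTransform hc hΩi hΩ2 (fun y => abs_le_const_of_env hC y) (ae_of_all _ hint) hhc hFΩ
    (ae_of_all _ (integrableOn_symmIntegrand_of_hasDerivAt hBd hBdc hBi))
    (SheetRWeakProfilePV.continuous_hilbertTransform_of_contDiff hB1 hBi) x

/-- **THE REAL-PART EQUATION `ε·H(Ω″) = ½(Ω² − (HΩ)²)`** (apply `H` to `εΩ″ = −Ω·HΩ` and use the Cotlar identity); with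
`h″ = H(Ω″)` (`corner_regularity`) this is `εh″ = ½(Ω² − h²)`, the imaginary part of `εW″ = (i/2)W²`. [new here — MODEL] -/
theorem corner_realPart {ε M C : ℝ} {U Om dOm ddOm : ℝ → ℝ} (hε : 0 < ε) (hodd : ∀ y, Om (-y) = -Om y)
    (hOm : ∀ ξ, HasDerivAt Om (dOm ξ) ξ) (hdOm : ∀ ξ, HasDerivAt dOm (ddOm ξ) ξ)
    (hM : ∀ y, |dOm y| ≤ M) (hC : ∀ y, |Om y| ≤ C / (1 + y ^ 2))
    (hF : ∀ ξ ∈ Ioi (0:ℝ), F1 0 0 0 1 ε (hilbertTransform Om) U Om dOm ddOm (fun _ => 0) ξ = 0) (x : ℝ) :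
    ε * hilbertTransform ddOm x = (Om x ^ 2 - hilbertTransform Om x ^ 2) / 2 := by
  have hode := corner_ode hodd hOm hdOm hF
  have hdd_eq : ddOm = fun y => (-ε⁻¹) * (Om y * hilbertTransform Om y) := by
    funext y; have := hode y; field_simp; linarith
  rw [hdd_eq, hilbertTransform_const_mul, corner_cotlar hε hodd hOm hdOm hM hC hF x]
  field_simp
  ring

/-! ### The census theorem -/

/-- **CLASSIFICATION OF THE SCHOCHET CORNER (census decl).** At the degenerate corner `(c_ω, c_l, a) = (0, 0, 0)` of the
NS-type line of the frozen-`ε` sheet, `ε > 0`: every odd `C²` profile `Ω` (`Ω′ = dOm`, `Ω″ = ddOm`) with `|Ω′| ≤ M`,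
`|Ω| ≤ C/(1+ξ²)`, solving `F₁(0, 0, 0, 1, ε; HΩ, 𝒰, Ω) ≡ 0` on `(0,∞)` with the GENUINE Hilbert transform `HΩ` (the
velocity `𝒰` is a free symbol: its coefficient is `a = 0`), is EITHER `Ω ≡ 0` OR a Schochet double pole
`Ω(η) = −24εℓ·η/(η² + ℓ²)²` for some `ℓ > 0`. Binders = those of `SheetHalfLine.nsTypeLine_empty_of_a_eq_zero` at
`c_ω := 0` minus `hcω`, `iH`, `hdOm1`. Proof: `W = Ω + iHΩ` solves `εW″ = (i/2)W²` with `W, W′ → 0`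
(`corner_ode`, `corner_regularity`, `corner_realPart`, Riemann–Lebesgue on `W = 𝓕⁻[(1+sgn)𝓕Ω]`);
`SheetNSLineCornerODE.classification_corner`; oddness kills `Re z₀`; `HΩ = Im W` against
`hilbertTransform_doublePole_dilate` forces `Im z₀ < 0`. WHAT THIS IS NOT: not NS; nothing for `a ≠ 0` or `c_ω ≠ 0`;
no dynamics. [new here — MODEL; converse of `SheetNSLineSchochetCorner.schochetCorner_solves_nsLine_equation`] -/
theorem corner_classification (ε M C : ℝ) (U Om dOm ddOm : ℝ → ℝ) (hε : 0 < ε)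
    (hodd : ∀ y, Om (-y) = -Om y)
    (hOm : ∀ ξ, HasDerivAt Om (dOm ξ) ξ) (hdOm : ∀ ξ, HasDerivAt dOm (ddOm ξ) ξ)
    (hM : ∀ y, |dOm y| ≤ M) (hC : ∀ y, |Om y| ≤ C / (1 + y ^ 2))
    (hF : ∀ ξ ∈ Ioi (0:ℝ), F1 0 0 0 1 ε (hilbertTransform Om) U Om dOm ddOm (fun _ => 0) ξ = 0) :
    Om = 0 ∨ ∃ ℓ : ℝ, 0 < ℓ ∧ Om = fun η => -(24 * ε * ℓ) * η / (η ^ 2 + ℓ ^ 2) ^ 2 := by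
  obtain ⟨hc, hdc, hΩi, hΩ2, hint, hhc, -⟩ := corner_basic hOm hdOm hM hC
  obtain ⟨hh', hHdc, -, hdOmi, hdOm2, hddd, -, hh''⟩ := corner_regularity hε hodd hOm hdOm hM hC hF
  obtain ⟨hFΩ, hFdΩ⟩ := corner_fourier_integrable hε hodd hOm hdOm hM hC hF
  have hode := corner_ode hodd hOm hdOm hF
  have hreal := corner_realPart hε hodd hOm hdOm hM hC hF
  have hddc : Continuous ddOm := continuous_iff_continuousAt.mpr fun x => (hddd x).continuousAt
  -- the analytic signal `W = Ω + ih` and its derivatives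
  set W : ℝ → ℂ := fun x => (Om x : ℂ) + I * hilbertTransform Om x with hW
  set dW : ℝ → ℂ := fun x => (dOm x : ℂ) + I * hilbertTransform dOm x with hdW
  set ddW : ℝ → ℂ := fun x => (ddOm x : ℂ) + I * hilbertTransform ddOm x with hddW
  have hWd : ∀ x, HasDerivAt W (dW x) x := fun x => (hOm x).ofReal_comp.add ((hh' x).ofReal_comp.const_mul I)
  have hdWd : ∀ x, HasDerivAt dW (ddW x) x := fun x => (hdOm x).ofReal_comp.add ((hh'' x).ofReal_comp.const_mul I)
  have hODE : ∀ x, (ε : ℂ) * ddW x = (I / 2) * W x ^ 2 := by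
    intro x
    have e1 : ((ε * ddOm x : ℝ) : ℂ) = ((-(hilbertTransform Om x * Om x) : ℝ) : ℂ) := by rw [hode x]
    have e2 : ((ε * hilbertTransform ddOm x : ℝ) : ℂ) = (((Om x ^ 2 - hilbertTransform Om x ^ 2) / 2 : ℝ) : ℂ) := by
      rw [hreal x]
    push_cast at e1 e2
    have hI : I * I = -1 := Complex.I_mul_I
    simp only [hW, hddW]
    linear_combination e1 + I * e2 - ((Om x : ℂ) * hilbertTransform Om x + I / 2 * (hilbertTransform Om x : ℂ) ^ 2) * hI
  -- limits at `+∞` (Riemann–Lebesgue on the analytic signals of `Ω` and `Ω′`)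
  have hneg : Tendsto (fun x : ℝ => -x) atTop (cocompact ℝ) := tendsto_neg_atTop_atBot.mono_right atBot_le_cocompact
  have hW0 : Tendsto W atTop (𝓝 0) := by
    have h := (Real.zero_at_infty_fourier
      (fun k => (1 + ((Real.sign k : ℝ) : ℂ)) * 𝓕 (fun y => (Om y : ℂ)) k)).comp hneg
    refine h.congr fun x => ?_
    simp only [hW, Function.comp]
    rw [analyticSignal_eq_fourierInv hc hΩi hΩ2 (ae_of_all _ hint) hhc hFΩ x, Real.fourierInv_eq_fourier_neg]
  have hdW0 : Tendsto dW atTop (𝓝 0) := by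
    have hint' := integrableOn_symmIntegrand_of_hasDerivAt hdOm hddc hdOmi
    have h := (Real.zero_at_infty_fourier
      (fun k => (1 + ((Real.sign k : ℝ) : ℂ)) * 𝓕 (fun y => (dOm y : ℂ)) k)).comp hneg
    refine h.congr fun x => ?_
    simp only [hdW, Function.comp]
    rw [analyticSignal_eq_fourierInv hdc hdOmi hdOm2 (ae_of_all _ hint') hHdc hFdΩ x, Real.fourierInv_eq_fourier_neg]
  -- the ODE classification
  rcases classification_corner hε.ne' W dW ddW hWd hdWd hODE hW0 hdW0 with hzero | ⟨z₀, hz₀, hWz⟩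
  · left
    funext x
    have h := congrArg Complex.re (congrFun hzero x)
    simpa [hW] using h
  · right
    have hre : ∀ x, Om x = 24 * ε * z₀.im * (x - z₀.re) / ((x - z₀.re) ^ 2 + z₀.im ^ 2) ^ 2 := fun x => by
      have h := congrArg Complex.re (hWz x)
      rw [doublePole_re ε hz₀ x] at h
      simpa [hW] using h
    have him : ∀ x, hilbertTransform Om x
        = -12 * ε * ((x - z₀.re) ^ 2 - z₀.im ^ 2) / ((x - z₀.re) ^ 2 + z₀.im ^ 2) ^ 2 := fun x => by
      have h := congrArg Complex.im (hWz x)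
      rw [doublePole_im ε hz₀ x] at h
      simpa [hW] using h
    -- oddness: `Re z₀ = 0`
    have hp : z₀.re = 0 := by
      have h0 : Om 0 = 0 := by have := hodd 0; simp at this; linarith
      rw [hre 0] at h0
      have hD : ((0 - z₀.re) ^ 2 + z₀.im ^ 2) ^ 2 ≠ 0 := by positivity
      have h1 : 24 * ε * z₀.im * (0 - z₀.re) = 0 := by
        rcases div_eq_zero_iff.mp h0 with h | h
        · exact h
        · exact absurd h hD
      have h2 : 24 * ε * z₀.im ≠ 0 := mul_ne_zero (mul_ne_zero (by norm_num) hε.ne') hz₀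
      have := (mul_eq_zero.mp h1).resolve_left h2
      linarith
    -- `Im z₀ < 0` from `HΩ = Im W` at `x = 0`
    have hq : z₀.im < 0 := by
      rcases lt_or_gt_of_ne hz₀ with h | h
      · exact h
      · exfalso
        set q := z₀.im with hqdef
        have hΩeq : Om = fun y => (24 * ε / q ^ 2) * ((y / q) / (1 + (y / q) ^ 2) ^ 2) := by
          funext y; rw [hre y, hp]; field_simp; ring
        have h1 := hilbertTransform_doublePole_dilate (24 * ε / q ^ 2) h 0
        rw [← hΩeq] at h1
        have h2 := him 0
        rw [hp] at h2
        rw [h2] at h1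
        field_simp at h1
        ring_nf at h1
        nlinarith [pow_pos h 6, pow_pos h 2, hε]
    refine ⟨-z₀.im, by linarith, funext fun η => ?_⟩
    rw [hre η, hp]
    ring

end SheetNSLineCorner
end Summit.NavierStokesRegularity.OSWSelfSimilar
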